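import Literature.NumberTheory.LFunctions.Zhang2022.KnifeEdgeThreePiece

/-!
# Zhang (2022), barrier-extension programme — the consistency condition `WorldLinearOn` of the rough joint verdict
# is LOAD-BEARING on its own

Y. Zhang, *Discrete mean estimates and the Landau–Siegel zero*, arXiv:2211.02515v1 (2022) [Zhang2022LandauSiegel] —
**unrefereed, under adjudication. WHAT THIS IS NOT: no claim about its Theorems 1–2, Landau–Siegel zeros, Parity or a
repaired `Margin232`; statements are about the CONTINUED CALCULUS in an abstract off-diagonal world `X` (registry
E-017 / E-002 open off `R`).** Cell `landau-siegel` §E, seat p1; companion of `KnifeEdgeThreePiece` (p461544, REF-E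
E-12) answering the referee's note N2 (2026-08-26T18:43:40Z).

`KnifeEdge.familyRoughTwoPieceJoint`'s verdict displays THREE world binders: `WorldLinearOn (RoughOverhangPiece θ) X`
(consistency of p442741's scalar convention: the world reads a combined in-class piece linearly), `BandNonnegOn`
(E-005), `CrossSubordinateOn` (E-006). p461544 showed the three are jointly inhabited (`exists_linear_slots_rough`) and
that dropping E-005/E-006 kills the verdict (`X = 0`). Here: **dropping `WorldLinearOn` ALONE kills it** — for every
`θ > 1` there is a world satisfying E-005 and E-006 on the rough class, NOT linear in the in-class slot, in which the
JOINT criterion `C₂₃₂·𝔅(f) < ‖𝔡+𝔡′‖²` CLOSES on a class member (`exists_nonlinear_slots_jointCloses`). The world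
pins a cross residual of exactly Cauchy–Schwarz size `√𝔅(f₀)` on ONE in-class profile `f₀ = 2ϰ_{1,5/2}` against the
plateau overhang (net block `1`), and `0` on every other in-class profile — subordinate everywhere (E-006 holds), but
not linear (`ϰ ↦ 0`, `2ϰ ↦ √𝔅(2ϰ) ≠ 0`); against the probe `f₀` the design `s·ϰ_{1,5/2} ⊕ plateau` then closes for every
`s > 0`. So the three binders of row 19 of the class of record are each load-bearing; none can be folded into the class
or dropped. [cite: Zhang2022LandauSiegel, §7 (7.2) p.44; §2 (2.18), (2.32)–(2.33)]
-/

noncomputable section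

open Real Complex ComplexConjugate Set
open _root_.MeasureTheory

namespace Literature.NumberTheory.LFunctions.Zhang2022

namespace KnifeEdge

open Repair

variable {θ : ℝ}

/-- The plateau overhang is not an in-class piece (it equals `1` at the wall) for `θ > 1`.
[cite: Zhang2022LandauSiegel, §7 (7.2) p.44] -/
theorem not_inClassPiece_plateau (hθ : 1 < θ) (w : ℝ → ℂ) : ¬ InClassPiece (plateau θ) w := by
  intro h
  have h1 := h.vanish 1 le_rfl
  rw [plateau_of_mem ⟨le_rfl, hθ⟩] at h1
  exact one_ne_zero h1

/-- `ϰ_{1,5/2}(0) ≠ 0`, so `ϰ_{1,5/2}` is neither the zero profile nor its own double.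
[cite: Zhang2022LandauSiegel, (2.23)–(2.25) p.9] -/
theorem kappaP_one_zero_ne : kappaP 1 (5/2) 0 ≠ 0 := by
  rw [kappaP_of_le (by norm_num : (0:ℝ) ≤ 1)]
  simp [Complex.exp_ne_zero]

/-- **`WorldLinearOn` is load-bearing on its own.** For every `θ > 1` there is a world `X` on the rough class with
`BandNonnegOn` (E-005) and `CrossSubordinateOn` (E-006), which is NOT linear in the in-class slot and in which the
joint criterion CLOSES on the member `s·ϰ_{1,5/2} ⊕ plateau_θ` of `familyRoughTwoPieceJoint` against the in-class
probe `2ϰ_{1,5/2}` (indeed for `s = 1`). [cite: Zhang2022LandauSiegel, §7 (7.2) p.44; §2 (2.32)–(2.33)] -/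
theorem exists_nonlinear_slots_jointCloses (hθ : 1 < θ) :
    ∃ X : PairFunctional, BandNonnegOn (RoughOverhangPiece θ) θ X ∧ CrossSubordinateOn (RoughOverhangPiece θ) θ X ∧
      ¬ WorldLinearOn (RoughOverhangPiece θ) X ∧
      familyRoughTwoPieceJoint.InClass
          ⟨θ, kappaP 1 (5/2), kappaP' 1 (5/2), plateau θ, fun _ => 0, 1,
            fun x => 2 * kappaP 1 (5/2) x, fun x => 2 * kappaP' 1 (5/2) x⟩ ∧
      twoPieceMainTerm θ X (kappaP 1 (5/2)) (kappaP' 1 (5/2)) (plateau θ) (fun _ => 0) 1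
          * mainTermForm (fun x => 2 * kappaP 1 (5/2) x) (fun x => 2 * kappaP' 1 (5/2) x)
        < ‖twoPieceCross θ X (kappaP 1 (5/2)) (kappaP' 1 (5/2)) (plateau θ) (fun _ => 0) 1
            (fun x => 2 * kappaP 1 (5/2) x) (fun x => 2 * kappaP' 1 (5/2) x)‖ ^ 2 := by
  classical
  -- the cast
  set κ : ℝ → ℂ := kappaP 1 (5/2) with hκ
  set κ' : ℝ → ℂ := kappaP' 1 (5/2) with hκ'
  set f₀ : ℝ → ℂ := fun x => 2 * κ x with hf₀
  set f₀' : ℝ → ℂ := fun x => 2 * κ' x with hf₀'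
  set v₀ : ℝ → ℂ := plateau θ with hv₀
  have hκin : InClassPiece κ κ' := inClassPiece_kappaP_one (5/2)
  have hfin : InClassPiece f₀ f₀' := by simpa [hf₀, hf₀', zero_mul, zero_add] using hκin.add_smul hκin 0 2
  have hv₀ : RoughOverhangPiece θ v₀ (fun _ => 0) := roughOverhangPiece_plateau θ
  have hv₀nin : ¬ InClassPiece v₀ (fun _ => 0) := not_inClassPiece_plateau hθ _
  set a : ℝ := mainTermForm κ κ' with ha
  have ha_pos : 0 < a := mainTermForm_kappaP_one_pos
  have hB : mainTermForm f₀ f₀' = 4 * a := by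
    rw [hf₀, hf₀', mainTermForm_smul hκin.kinked.isH1]; norm_num [ha]
  have hP : mainTermFormPolar κ κ' f₀ f₀' = ((2 * a : ℝ) : ℂ) := by
    rw [hf₀, hf₀', mainTermFormPolar_swap, mainTermFormPolar_smul_left hκin.kinked.isH1 hκin.kinked.isH1,
      mainTermFormPolar_self, map_mul, Complex.conj_ofReal, map_ofNat, ← ha]
    push_cast; ring
  -- `κ` is not `f₀` (evaluate at `0`)
  have hne : ¬ (κ = f₀ ∧ κ' = f₀') := by
    rintro ⟨h, -⟩
    have h0 := congrFun h 0
    simp only [hf₀] at h0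
    have : κ 0 = 0 := by linear_combination -h0
    exact kappaP_one_zero_ne this
  -- the world
  set c₂ : ℝ := Real.sqrt (4 * a) with hc₂
  have hc₂sq : c₂ ^ 2 = 4 * a := Real.sq_sqrt (by linarith)
  have hc₂pos : 0 < c₂ := Real.sqrt_pos.2 (by linarith)
  set X : PairFunctional := fun p p' q q' =>
    if InClassPiece p p' then
      -((π : ℂ) * conj (overhangMass θ q) * tailFunctional p)
        + (if p = f₀ ∧ p' = f₀' ∧ q = v₀ ∧ q' = (fun _ => 0) then (c₂ : ℂ) else 0)
    else if RoughOverhangPiece θ p p' ∧ p = q ∧ p' = q' then (((1 - (topDiagForm θ q q').re) / 2 : ℝ) : ℂ) else 0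
    with hX
  -- values of the world
  have Xin : ∀ p p' q q', InClassPiece p p' →
      X p p' q q' = -((π : ℂ) * conj (overhangMass θ q) * tailFunctional p)
        + (if p = f₀ ∧ p' = f₀' ∧ q = v₀ ∧ q' = (fun _ => 0) then (c₂ : ℂ) else 0) := by
    intro p p' q q' hp; simp only [hX, if_pos hp]
  have Xdiag : ∀ q q', RoughOverhangPiece θ q q' → ¬ InClassPiece q q' →
      X q q' q q' = (((1 - (topDiagForm θ q q').re) / 2 : ℝ) : ℂ) := by
    intro q q' hq hqn; simp only [hX, if_neg hqn, hq, and_self, if_true]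
  -- net blocks: `1` on genuinely rough pieces, `0` on the zero piece
  have hband : ∀ q q', RoughOverhangPiece θ q q' →
      netOverhangBlock θ X q q' = if InClassPiece q q' then 0 else 1 := by
    intro q q' hq
    unfold netOverhangBlock
    by_cases hqi : InClassPiece q q'
    · obtain ⟨h0, h0'⟩ := eq_zero_of_inClass_of_rough hqi hq
      subst h0 h0'
      have hf0 : ¬ ((0 : ℝ → ℂ) = f₀ ∧ (0 : ℝ → ℂ) = f₀' ∧ (0 : ℝ → ℂ) = v₀ ∧ (0 : ℝ → ℂ) = (fun _ => 0)) := by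
        rintro ⟨h, -⟩
        have h0 := congrFun h 0
        simp only [hf₀, Pi.zero_apply] at h0
        exact kappaP_one_zero_ne (by linear_combination -h0 / 2)
      rw [if_pos hqi, Xin _ _ _ _ hqi, if_neg hf0]
      simp [topDiagForm, MformTop, dipoleIntegrandTop, overhangMass, tailFunctional]
    · rw [if_neg hqi, Xdiag q q' hq hqi, Complex.ofReal_re]; ring
  -- cross residuals: `c₂` at (f₀, v₀), `0` elsewhere
  have hcross : ∀ p p' q q', InClassPiece p p' →
      crossResidual θ X p p' q q' = if p = f₀ ∧ p' = f₀' ∧ q = v₀ ∧ q' = (fun _ => 0) then (c₂ : ℂ) else 0 := by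
    intro p p' q q' hp
    unfold crossResidual
    rw [Xin _ _ _ _ hp]; ring
  refine ⟨X, ?_, ?_, ?_, ⟨hθ.le, hκin, hv₀, hfin⟩, ?_⟩
  · -- E-005
    intro q q' hq
    rw [hband q q' hq]; split_ifs <;> norm_num
  · -- E-006
    intro p p' q q' hp hq
    rw [hcross _ _ _ _ hp, hband q q' hq]
    by_cases hc : p = f₀ ∧ p' = f₀' ∧ q = v₀ ∧ q' = (fun _ => 0)
    · obtain ⟨rfl, rfl, rfl, rfl⟩ := hc
      rw [if_pos ⟨rfl, rfl, rfl, rfl⟩, if_neg hv₀nin, hB, Complex.norm_real, Real.norm_eq_abs, sq_abs, hc₂sq, mul_one]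
    · rw [if_neg hc, norm_zero]
      have := mainTermForm_nonneg_of_isH1 hp.kinked.isH1
      split_ifs <;> nlinarith
  · -- not linear: `2·κ + 0·κ` is `f₀`, but `X(f₀, v₀) ≠ 2·X(κ, v₀) + 0·X(κ, v₀)`
    intro hlin
    have key := hlin κ κ' κ κ' v₀ (fun _ => 0) 2 0 hκin hκin hv₀
    have e1 : (fun x => (2:ℂ) * κ x + 0 * κ x) = f₀ := by funext x; simp [hf₀]
    have e2 : (fun x => (2:ℂ) * κ' x + 0 * κ' x) = f₀' := by funext x; simp [hf₀']
    have hL : tailFunctional f₀ = 2 * tailFunctional κ := by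
      rw [← e1, tailFunctional_add_smul hκin hκin]; ring
    rw [e1, e2, Xin _ _ _ _ hfin, Xin _ _ _ _ hκin, if_pos ⟨rfl, rfl, rfl, rfl⟩,
      if_neg (fun h => hne ⟨h.1, h.2.1⟩), hL] at key
    have : (c₂ : ℂ) = 0 := by linear_combination key
    exact hc₂pos.ne' (by exact_mod_cast this)
  · -- the joint criterion closes for `s = 1`: `(a + 1)·4a < (2a + c₂)²`
    have hC232 : twoPieceMainTerm θ X κ κ' v₀ (fun _ => 0) 1 = a + 1 := by
      rw [twoPieceMainTerm_eq_pencil, hcross _ _ _ _ hκin, if_neg (fun h => hne ⟨h.1, h.2.1⟩), hband _ _ hv₀,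
        if_neg hv₀nin, ← ha]
      simp
    have hcr : twoPieceCross θ X κ κ' v₀ (fun _ => 0) 1 f₀ f₀' = ((2 * a + c₂ : ℝ) : ℂ) := by
      have : twoPieceCross θ X κ κ' v₀ (fun _ => 0) 1 f₀ f₀'
          = 1 * mainTermFormPolar κ κ' f₀ f₀' + conj (crossResidual θ X f₀ f₀' v₀ (fun _ => 0)) := by
        unfold twoPieceCross crossResidual; rfl
      rw [this, hP, hcross _ _ _ _ hfin, if_pos ⟨rfl, rfl, rfl, rfl⟩, Complex.conj_ofReal]
      push_cast; ring
    rw [hC232, hB, hcr, Complex.norm_real, Real.norm_eq_abs, sq_abs]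
    nlinarith [hc₂sq, mul_pos ha_pos hc₂pos]

end KnifeEdge

end Literature.NumberTheory.LFunctions.Zhang2022
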